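import Summits.CriticalPhenomena.PercolationContinuityZ3.Theorems.PercNearOneGluingNoHeavyQuantDIBStarResidual
import Summits.CriticalPhenomena.PercolationContinuityZ3.Theorems.PercNearOneGluingNoHeavyQuantDIBStarFloorSplitInductionLumpyPC
import HarnessLib

/-!
# QUANT lane R8, Conjecture DIB\* — concordance of the two "non-completing pair" narrowings: `StepLemmaFSResidual` (typer g20) ≡ `StepLemmaFSLumpyPC` (lead g18)

builds on p205010 (kernel theorem, internal audit signed; external expert review pending)

Support file (`--supports stmt-CriticalPhenomena-4575`), QUANT lane typer seat prim-quant-stmt (gen 20).  Theorems only, NO new statement.  Two typed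
narrowings of the floor-split step lemma by typer g20's pairwise-completion theorem (`tail_ge_of_pairCompleting`, p265419) landed within minutes of each
other: `IndepBlob.StepLemmaFSResidual` (`…QuantDIBStarResidual`, p266084: `StepLemmaFSCore` + a non-completing pair) and the lead's
`IndepBlob.StepLemmaFSLumpyPC` (`…FloorSplitInductionLumpyPC`, p266400: `StepLemmaFSLumpy` + a non-completing pair — the NARROWER hypothesis block, with
empty blobs sure, three lights and non-granularity).  This file records that they are the same open problem and that **`StepLemmaFSLumpyPC` is the class
of record** (README V222 (d)); `StepLemmaFSResidual` is a way-point between `StepLemmaFSCore` and it: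

* `stepLemmaFSResidual_of_core : StepLemmaFSCore → StepLemmaFSResidual` (drop the extra hypothesis);
* `stepLemmaFSResidual_of_lumpyPC : StepLemmaFSLumpyPC → StepLemmaFSResidual` (lead g18's dispatch `stepLemmaFSCore_of_lumpy ∘ stepLemmaFSLumpy_of_lumpyPC`);
* `stepLemmaFSLumpyPC_of_residual : StepLemmaFSResidual → StepLemmaFSLumpyPC` (through `∀ x < 1, DIBStar x`);
* `stepLemmaFSResidual_iff_lumpyPC`, and `stepLemmaFSLumpyPC_of_fseResidual : FSEResidual → StepLemmaFSLumpyPC`.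
[this work]
-/

namespace Summit.CriticalPhenomena.PercolationContinuityZ3.Theorems

namespace Quant

namespace IndepBlob

/-- `StepLemmaFSCore → StepLemmaFSResidual` (the residual statement has one more hypothesis). [this work] -/
theorem stepLemmaFSResidual_of_core (H : StepLemmaFSCore) : StepLemmaFSResidual :=
  fun κ _ _ a g j x hx hx1 hg hlight hcorner hnogiant htwo hbig hpos hcore _ hcredit hIH =>
    H κ a g j x hx hx1 hg hlight hcorner hnogiant htwo hbig hpos hcore hcredit hIH

/-- **`StepLemmaFSLumpyPC → StepLemmaFSResidual`** (lead g18's dispatch of empty blobs / granular systems / two lights, then drop a hypothesis). [this work] -/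
theorem stepLemmaFSResidual_of_lumpyPC (H : StepLemmaFSLumpyPC) : StepLemmaFSResidual :=
  stepLemmaFSResidual_of_core (RootDec.stepLemmaFSCore_of_lumpy (stepLemmaFSLumpy_of_lumpyPC H))

/-- **`StepLemmaFSResidual → StepLemmaFSLumpyPC`** (through `∀ x < 1, DIBStar x`). [this work] -/
theorem stepLemmaFSLumpyPC_of_residual (H : StepLemmaFSResidual) : StepLemmaFSLumpyPC :=
  stepLemmaFSLumpyPC_of_dibStar (dibStar_of_stepLemmaFSResidual H)

/-- **The two narrowings are equivalent**: `StepLemmaFSResidual ↔ StepLemmaFSLumpyPC` (both `↔ ∀ x < 1, DIBStar x`); `StepLemmaFSLumpyPC` is the class of record.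
[this work] -/
theorem stepLemmaFSResidual_iff_lumpyPC : StepLemmaFSResidual ↔ StepLemmaFSLumpyPC :=
  ⟨stepLemmaFSLumpyPC_of_residual, stepLemmaFSResidual_of_lumpyPC⟩

/-- `FSEResidual → StepLemmaFSLumpyPC` (a closed-form certificate solution of FS-E on the residual class settles the class of record). [this work] -/
theorem stepLemmaFSLumpyPC_of_fseResidual (H : FSEResidual) : StepLemmaFSLumpyPC :=
  stepLemmaFSLumpyPC_of_dibStar (dibStar_of_fseResidual H)

end IndepBlob

end Quant

end Summit.CriticalPhenomena.PercolationContinuityZ3.Theorems
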